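import Summits.BirchSwinnertonDyer.BirchSwinnertonDyer.Theorems.SignedBaseChangeAnticyclotomicEisensteinDivisibilityBdpLowerHalfAdditive
import Summits.BirchSwinnertonDyer.BirchSwinnertonDyer.Theorems.SignedBaseChangeAnticyclotomicEisensteinDivisibilityBdpLowerHalfAdditiveCell
import HarnessLib

/-! # Line `bdpline`: S1 `stub_bdpLowerHalfRatSS` on the ALL-ADDITIVE cell with CHECKABLE binders
# (`¬ p ∣ h_K`, `∀ ℓ ∣ N, ℓ² ∣ N`) — PRINT modulo ONE named fact

Crux `AnticyclotomicEisensteinDivisibility` (stmt-BirchSwinnertonDyer-20727, route `SignedBaseChange`), line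
`bdpline`, lead bsd-line-sbc-p1 gen 4. Assembly of the two siblings: `…BdpLowerHalfAdditive.lean` (S1's text
with Bertolini–Longo–Venerucci's Hyp. 1.1 bullet 5 as a binder, from the named fact
`BertoliniLongoVenerucci2026.thmA_castellaWan_thm68_exists_isCWBDPLFunction_charIdeal_map_le_rat` and the frame
concordance p634869) and `…BdpLowerHalfAdditiveCell.lean` (bullet 5 DISCHARGED at `p ≥ 5` from `ℓ² ∣ N` for
every `ℓ ∣ N`, Kodaira–Néron). Result: the registered text of S1 with the two binders
`¬ p ∣ NumberField.classNumber K` and `∀ ℓ : ℕ, ℓ.Prime → ℓ ∣ N → ℓ ^ 2 ∣ N` inserted after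
`κ₂.IsAnticyclotomic →` — i.e. **on the cell {`N_E` squarefull (every bad prime additive)} × {`p ∤ h_K`} of the
crux's supersingular slice, S1 is PRINT modulo that single named fact** (two refereed sources; reliability
flag `BLV-step4-Wan` in the fact's docstring). Off that cell S1 stays research (registered stub). This file
imports the route file through S1's text (`SignedTwoVariableInputs`), like its first sibling; the kernel
lemmas live in the route-independent second sibling. No summit statement is proved here; BSD / the crux are
NOT proved by this file.
-/

-- D-0017: single-problem summit, the namespace repeats the problem name by design.
set_option linter.dupNamespace false
set_option autoImplicit false

noncomputable section

open scoped Classical NumberField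

open NumberField IsDedekindDomain Field
  Literature.NumberTheory.EllipticCurves Literature.NumberTheory.EllipticCurves.ModularForms
  Literature.NumberTheory.EllipticCurves.Rank1Residual Literature.NumberTheory.GaloisRepresentations
  Summit.BirchSwinnertonDyer.BirchSwinnertonDyer.Theorems

namespace Summit.BirchSwinnertonDyer.BirchSwinnertonDyer.Theorems.SignedBaseChangeAcDivBdpLowerHalfAllAdditive

open Summit.BirchSwinnertonDyer.BirchSwinnertonDyer.Theses.SignedBaseChange


/-- **S1 `stub_bdpLowerHalfRatSS` on the cell {every prime of `N` divides `N²`-wise, i.e. `ℓ² ∣ N`} × {`p ∤ h_K`}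
(PRINT modulo ONE named fact).** The registered text of line `bdpline`'s S1 with the two binders
`¬ p ∣ NumberField.classNumber K` and `∀ ℓ ∣ N` prime, `ℓ ^ 2 ∣ N` inserted after `κ₂.IsAnticyclotomic →`, from
`SignedBaseChangeAcDivAdditiveCell.blvBulletFive_of_forall_sq_dvd` and `SignedBaseChangeAcDivBdpLowerHalfAdditive.bdpLowerHalfRatSS_additive_of_BLV`.
[cite: BertoliniLongoVenerucci2026, Thm. A with Hyp. 1.1 (arXiv:2306.17784 p0003)] [cite: CastellaWan2023, Thm. 6.8 (MS pp. 29–31)]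
[cite: SilvermanAEC2009, Thm. VII.6.1] -/
theorem bdpLowerHalfRatSS_allAdditive_of_BLV
    (hBLV : BertoliniLongoVenerucci2026.thmA_castellaWan_thm68_exists_isCWBDPLFunction_charIdeal_map_le_rat) :
    SignedTwoVariableInputs → Literature.NumberTheory.EllipticCurves.ModularForms.nonempty_modularParametrizationData → ∀ (W : WeierstrassCurve ℚ) [W.IsElliptic] [W.IsGloballyMinimal] (p : ℕ) [Fact p.Prime], 5 ≤ p → W.HasGoodReductionAtPrime p → W.frobeniusTrace p = 0 → Literature.NumberTheory.EllipticCurves.Rank1Residual.Surj W p → ∀ (K : Type) [Field K] [NumberField K] (ι : PadicAlgCl p ≃+* ℂ) (v vbar : IsDedekindDomain.HeightOneSpectrum (NumberField.RingOfIntegers K)) (κ₁ κ₂ : Literature.NumberTheory.EllipticCurves.ZpExtension K p) (γ₁ γ₂ : Field.absoluteGaloisGroup K) [Fact (Literature.NumberTheory.EllipticCurves.ZpExtension.IsTopGeneratorPair κ₁ κ₂ γ₁ γ₂)] [NeZero (NumberField.discr K).natAbs] (N : ℕ) [NeZero N] (f : CuspForm (CongruenceSubgroup.Gamma0 N) 2),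 Literature.NumberTheory.EllipticCurves.ModularForms.IsNewformOf W f → (N : ℤ) = W.conductorNorm ℤ → Literature.NumberTheory.EllipticCurves.IsImaginaryQuadratic K → ((Ideal.span {(p : ℤ)}).primesOver (NumberField.RingOfIntegers K)).ncard = 2 → ((p : ℕ) : NumberField.RingOfIntegers K) ∈ v.asIdeal → ((p : ℕ) : NumberField.RingOfIntegers K) ∈ vbar.asIdeal → vbar ≠ v → (∀ (w : NumberField.InfinitePlace K) (k : NumberField.RingOfIntegers K), k ∈ v.asIdeal ↔ ‖ι.symm (w.embedding (k : K))‖ < 1) → IsCoprime (N : ℤ) (NumberField.discr K) → (∀ ℓ : ℕ, ℓ.Prime → ℓ ∣ N → ((Ideal.span {(ℓ : ℤ)}).primesOver (NumberField.RingOfIntegers K)).ncard = 2) → Odd (NumberField.discr K) → NumberField.discr K ≠ -3 → κ₁.IsCyclotomic → κ₂.IsAnticyclotomic → ¬ p ∣ NumberField.classNumber K → (∀ ℓ : ℕ, ℓ.Prime → ℓ ∣ N → ℓ ^ 2 ∣ N) → (haveI : Fact (κ₂.IsTopGenerator γ₂) := ⟨Literature.NumberTheory.EllipticCurves.YanZhu2026.isTopGenerator_of_pair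 (κ₁ := κ₁) (γ₁ := γ₁)⟩; Module.IsTorsion (Literature.NumberTheory.EllipticCurves.IwasawaAlgebra p) (Literature.NumberTheory.EllipticCurves.Castella2018.AcSelmer.XAc (W.baseChange K) p κ₂ vbar ∅ γ₂)) → ∀ (ΩK : ℂ) (Ωp' : (Literature.NumberTheory.EllipticCurves.unrIntegers p)ˣ) (L : Literature.NumberTheory.EllipticCurves.UnrSeries p), ΩK ≠ 0 → Literature.NumberTheory.EllipticCurves.IsBDPLFunction ι v κ₂ γ₂ f ΩK ((Ωp' : Literature.NumberTheory.EllipticCurves.unrIntegers p) : PadicComplex p) L → ∀ J : ℤ_[p] →+* PadicComplexInt p, (∀ x : ℤ_[p], ((J x : PadicComplexInt p) : PadicComplex p) = ((x : ℚ_[p]) : PadicComplex p)) → ∀ (J₀ : Literature.NumberTheory.EllipticCurves.unrIntegers p →+* PadicComplexInt p), (∀ x : Literature.NumberTheory.EllipticCurves.unrIntegers p, ((J₀ x : PadicComplexInt p) : PadicComplex p) = (x : PadicComplex p)) → ∃ k : ℕ, ∀ y ∈ (haveI : Fact (κ₂.IsTopGenerator γ₂) := ⟨Literature.NumberTheory.EllipticCurves.YanZhu2026.isTopGenerator_of_pair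 (κ₁ := κ₁) (γ₁ := γ₁)⟩; Literature.NumberTheory.EllipticCurves.Castella2018.AcSelmer.XAc.charIdeal (W.baseChange K) p κ₂ vbar ∅ γ₂).map (PowerSeries.map J), PowerSeries.C (((p : ℕ) : PadicComplexInt p) ^ k) * y ∈ Ideal.span {PowerSeries.map J₀ L} := by
  intro hIn hmodP W _ _ p _ hp hgood ha0 hs K _ _ ι v vbar κ₁ κ₂ γ₁ γ₂ _ _ N _ f hf hN hK hsplit hv hvbar hvv hι hcop hHeeg hodd
    hne3 hκ₁ hκ₂ hh hsq
  exact SignedBaseChangeAcDivBdpLowerHalfAdditive.bdpLowerHalfRatSS_additive_of_BLV hBLV hIn hmodP W p hp hgood ha0 hs K ι v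
    vbar κ₁ κ₂ γ₁ γ₂ N f hf hN hK hsplit hv hvbar hvv hι hcop hHeeg hodd hne3 hκ₁ hκ₂ hh
    (SignedBaseChangeAcDivAdditiveCell.blvBulletFive_of_forall_sq_dvd W p hp hgood hN hsq)


end Summit.BirchSwinnertonDyer.BirchSwinnertonDyer.Theorems.SignedBaseChangeAcDivBdpLowerHalfAllAdditive

end
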